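import Literature.MathematicalPhysics.QuantumFieldTheory.Balaban1983to89.B9Eq3126HTransposeScaledMajorant
import Literature.MathematicalPhysics.QuantumFieldTheory.Balaban1983to89.Node00.OpsYSectDCoordsQ

/-!
# `Balaban1983to89.B9Eq3126HTransposeCoordsQ` — T. Bałaban, *Propagators for lattice gauge theories in a background field*, Commun. Math. Phys. **99** (1985)
# 389–434 [Balaban1985BackgroundPropagators], (3.126) p. 420 READ BACKWARDS OVER A GENERIC AVERAGING PAIR `(𝔮, 𝔮⋆)`: the counting-transpose of the model of
# `H[𝔮] = G̃[𝔮] 𝔮⋆ (𝔮G̃𝔮⋆)⁻¹` is `(C[𝔮] ∘ 𝔮) ∘ G̃[𝔮]`, and its scaled [4]-(2.51) majorant follows from the letters of `G̃`, `C` and a DISPLAYED (3.15) block law of `𝔮`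
# — the `𝔮`-generic editions of n06-w8's `B9Eq3126HTransposeCoords` §1 and this seat's `B9Eq3126HTransposeScaledMajorant` §2

statement-level skeleton of published theorems with citation tags; proofs where landed; nothing here is a claim about the Yang–Mills mass gap

THE PRINT.  p. 420 (3.126) *«HB = GQ\*(QGQ\*)⁻¹B»*; p. 392–393: `Q\*` the adjoint of `Q` ((3.13)); Thm 3.11 p. 416 («symmetric»); (3.123)∕(3.132) `(QGQ\*)⁻¹`; (3.115) p. 418:
print's `Q` is the composite (knit) averaging of [5]; (3.14)–(3.15) p. 393 (the block sizes of `Q`).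

WHY THIS FILE (cell `pub-ymgap`, node N06, seat `dag-n06-l` = bundle F7 rows 20–21, gen 38; road «P-D2-knit»).  The knit certificate's Sect.-D network «KD» (dag-n06-d)
displays the (3.137) letter `hD2supK`; its supplier is this seat's P-D2 prechain (`…N06D2SupPrechainV2AtPinsPUW`) re-pressed at print's knit pair, whose transpose road
(n06-w8: `(H\*J)` via the counting-transpose of `H`) reads `H ∕ C ∕ Q` in coordinates.  node00-def-Y's `OpsYSectDCoordsQ` (W6) supplies the `𝔮`-generic coordinate letters
(`QcoKHq ∕ QscoKHq ∕ CcoKq`, `HcoK_HDQY_eq`, `isTransposePair_QcoKHq_QscoKHq`); THIS FILE is the `𝔮`-generic edition of the two transpose facts the road consumes: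
(§1) `isTransposePair_CcoKq` ∕ ★ `isTransposePair_HcoK_HDQY` — the model of `C[𝔮] = (𝔮G̃𝔮⋆)⁻¹` is its own counting-transpose and the transpose of `H[𝔮]`'s model is
`(CcoKq ∘ QcoKHq) ∘ GcoK(G̃[𝔮])`, from the DISPLAYED adjointness `IsAdjTr 1 1 (𝔮 U) (𝔮⋆ U)` and the DISPLAYED symmetry `IsSymmTr 1 (G̃[𝔮](U))` (def-Y
`QGQinvOfQY_isSymmTr`, n06-d `isTransposePair_coordOpK_of_isSymmTr ∕ isTransposePair_GcoK_trBasis`); (§2) ★★ `hasMajorantHom_CQG_of_letters_sq_q` — this seat's scaled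
transpose majorant with n06-w5's theorem of the straight `Q` replaced by a displayed (3.15) block law of `𝔮` at every rate (`B_Q·e^{δ(ℓ+4)}·e^{−δd}`; at the knit pair
dag-n06-l `hasMajorantHom_QcoKHq_of_rowKernel`), proof text otherwise verbatim.

WHAT IS PROVED (sorry-free, 0 `def`).  §1 `isTransposePair_CcoKq`, ★ `isTransposePair_HcoK_HDQY`; §2 ★★ `hasMajorantHom_CQG_of_letters_sq_q`.
HONEST SCOPE.  Finite-dimensional transposition bookkeeping and [4] (2.51)∕(2.55)∕(2.61) with explicit constants; the letters of `G̃`, `C`, `𝔮` and the symmetry ∕ adjointness are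
HYPOTHESES; nothing of [B9] asserted; count-neutral; N06 NOT discharged; nothing continuum ∕ OS ∕ mass gap ∕ Clay.  NEW file; `B9Eq3126HTransposeCoords`,
`B9Eq3126HTransposeScaledMajorant`, `Node00.OpsYSectDCoordsQ` used BY NAME, nothing restated.
-/

noncomputable section

namespace Literature.MathematicalPhysics.QuantumFieldTheory.Balaban1983to89.B9Eq3126HTransposeCoordsQ

open Node00 (CfgY FBondY IBondY SiteParY SiteOpY parBY QGQinvOfQY_isSymmTr GDQY HDQY QGQinvQY)
open Node00.OpsYSectDCoords (cR39_trBasis_pos)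
open Node00.OpsYSectDCoordsQ (HcoK_HDQY_eq isTransposePair_QcoKHq_QscoKHq)
open Node00.OpsYOps312OfRecordPar (QcoKHq QscoKHq CcoKq)
open Node00.OpsYQLetter (QLetterY QsLetterY)
open B6KLevelCensusIndexV1 (KIdx)
open B9Thm37Glue (IsTransposePair)
open B9Thm37GlueTorusCov (isTransposePair_smul)
open B6RandomWalk (HasMajorant)
open B6RandomWalkHom (HasMajorantHom hasMajorantHom_comp hasMajorantHom_mono hasMajorantHom_iff)
open B9Thm34Ext (toB6)
open B11SectG (RowSum)
open B9Thm312Whole (GeoOK)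
open B9RWSums343to347Whole (Facts347)
open B9CoReadingCoords (XBK blkBK GcoK)
open B9CoReadingCoordsH (XHK blkHK HcoK)
open B9CoReadingCoordsTranspose (TrIdx trBasis trBasis_repr_eq_trace isTransposePair_coordOpK_of_isSymmTr isTransposePair_GcoK_trBasis)
open B9Thm311ReadingCoords (IsSymmTr IsAdjTr)
open B9Thm39ReadingCoords (cR39)
open B9GeoNormsKLevelV1 (geo9K)
open B9Eq3126HTransposeScaledMajorant (sum_exp_mul_lensq_le)
open scoped Matrix
open scoped Matrix.Norms.L2Operator

variable {N : ℕ} {d ℓ : ℕ} {hd : 1 ≤ d + 1} {hL : Odd (ℓ + 1) ∧ 1 < ℓ + 1} {b₀ b₁ : ℝ}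
variable (i : KIdx d ℓ hd hL b₀ b₁) (B : B9.Backgrounds) (cfg : B.Cfg → CfgY (Matrix (Fin N) (Fin N) ℂ) i)
  (𝔮 : QLetterY (Matrix (Fin N) (Fin N) ℂ) i) (𝔮s : QsLetterY (Matrix (Fin N) (Fin N) ℂ) i)
  (parS : SiteParY (Matrix (Fin N) (Fin N) ℂ) i) (Gp : SiteOpY (Matrix (Fin N) (Fin N) ℂ) i)

/-! ## §1 The counting-transpose of the `H[𝔮]`-model is `(C[𝔮] ∘ 𝔮) ∘ G̃[𝔮]` -/

section Transpose

/-- ★ **THE MODEL OF `C[𝔮] = (𝔮G̃𝔮⋆)⁻¹` IS ITS OWN COUNTING-TRANSPOSE** whenever the pair is adjoint in the trace pairing at `U` and `G̃[𝔮](U)` is trace-symmetric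
(def-Y `QGQinvOfQY_isSymmTr`; an orthonormal real basis turns trace-symmetry into counting-transposition). [cite: Balaban1985BackgroundPropagators, (3.123) p.420, (3.132) p.422, p.393 (Q* the adjoint of Q), (3.115) p.418; Balaban1984PropagatorsII, (2.51) p.232] -/
theorem isTransposePair_CcoKq (U₁ : B.Cfg) (hQ : IsAdjTr (fun _ => (1 : ℝ)) (fun _ => (1 : ℝ)) (𝔮 (cfg U₁)) (𝔮s (cfg U₁)))
    (hGD : IsSymmTr (fun _ => (1 : ℝ)) (GDQY i 𝔮 𝔮s parS Gp (cfg U₁))) :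
    IsTransposePair (CcoKq i (trBasis N) B cfg 𝔮 𝔮s parS Gp U₁) (CcoKq i (trBasis N) B cfg 𝔮 𝔮s parS Gp U₁) := by
  have hC : IsSymmTr (fun _ => (1 : ℝ)) (QGQinvQY i 𝔮 𝔮s parS Gp (cfg U₁)) :=
    QGQinvOfQY_isSymmTr i 𝔮 𝔮s (cfg U₁) (GDQY i 𝔮 𝔮s parS Gp) hQ hGD
  unfold CcoKq
  exact isTransposePair_smul (isTransposePair_coordOpK_of_isSymmTr (trBasis N) (trBasis_repr_eq_trace N) _ hC) _

/-- ★ **THE COUNTING-TRANSPOSE OF THE `H[𝔮]`-MODEL IS `(C[𝔮] ∘ 𝔮) ∘ G̃[𝔮]`** ((3.126) read backwards, generic pair): `IsTransposePair (HcoK … (HDQY i 𝔮 𝔮⋆ parS Gp) U₁)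
((CcoKq … ∘ₗ QcoKHq … 𝔮 …) ∘ₗ GcoK … (GDQY i 𝔮 𝔮⋆ parS Gp) U₁)` from the displayed adjointness of the pair and symmetry of `G̃[𝔮](U)` — def-Y's `HcoK_HDQY_eq` and
`isTransposePair_QcoKHq_QscoKHq`, n06-d's `isTransposePair_GcoK_trBasis`, `isTransposePair_CcoKq`, `IsTransposePair.comp`.
[cite: Balaban1985BackgroundPropagators, (3.126) p.420, p.393, Thm 3.11 p.416, (3.115) p.418; Balaban1984PropagatorsII, (2.51) p.232] -/
theorem isTransposePair_HcoK_HDQY (hN : 0 < N) (U₁ : B.Cfg) (hQ : IsAdjTr (fun _ => (1 : ℝ)) (fun _ => (1 : ℝ)) (𝔮 (cfg U₁)) (𝔮s (cfg U₁)))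
    (hGD : IsSymmTr (fun _ => (1 : ℝ)) (GDQY i 𝔮 𝔮s parS Gp (cfg U₁))) :
    IsTransposePair (HcoK i (trBasis N) B cfg (HDQY i 𝔮 𝔮s parS Gp) U₁)
      ((CcoKq i (trBasis N) B cfg 𝔮 𝔮s parS Gp U₁ ∘ₗ QcoKHq i (trBasis N) B cfg 𝔮 U₁) ∘ₗ GcoK i (trBasis N) B cfg (GDQY i 𝔮 𝔮s parS Gp) U₁) := by
  have hc : cR39 (trBasis N) ≠ 0 := (cR39_trBasis_pos hN).ne'
  rw [HcoK_HDQY_eq (i := i) (b := trBasis N) (B := B) (cfg := cfg) (𝔮 := 𝔮) (𝔮s := 𝔮s) (parS := parS) (Gp := Gp) hc U₁]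
  have hGt := isTransposePair_GcoK_trBasis i B cfg (GDQY i 𝔮 𝔮s parS Gp) U₁ hGD
  have hQt : IsTransposePair (QscoKHq i (trBasis N) B cfg 𝔮s U₁) (QcoKHq i (trBasis N) B cfg 𝔮 U₁) :=
    (isTransposePair_QcoKHq_QscoKHq i B cfg U₁ 𝔮 𝔮s hQ).symm
  have hCt := isTransposePair_CcoKq i B cfg 𝔮 𝔮s parS Gp U₁ hQ hGD
  exact (hCt.comp hQt).comp hGt

end Transpose

/-! ## §2 The scaled [4]-(2.51) majorant of `(C ∘ 𝔮) ∘ G_D` with a displayed block law of `𝔮` -/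

section Majorant

variable {R₀ : ℝ} {H₀ : Prop}

/-- ★★ **THE TRANSPOSE COMPOSITE `(C ∘ 𝔮) ∘ G_D` FROM THE SCALED LETTER OF `G_D`, FOR A GENERIC AVERAGING LETTER `𝔮` WITH A DISPLAYED (3.15) BLOCK LAW** — the
`𝔮`-generic edition of `B9Eq3126HTransposeScaledMajorant.hasMajorantHom_CQG_of_letters_sq` (same proof text): n06-w5's theorem `hasMajorantHom_QcoKH` (the straight `Q`
is local: `e^{δ(ℓ+4)}·e^{−δd}` at any rate) is replaced by the LAW `hQ15 : ∀ δ ≥ 0, HasMajorantHom blkBK blkHK (QcoKHq … 𝔮 U₁) (B_Q·e^{δ(ℓ+4)}·e^{−δd})` (at print's knit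
`Q` of (3.115): dag-n06-l `…Thm312313ParLawsQRow.hasMajorantHom_QcoKHq_of_rowKernel` from the knit row kernel on (3.35), `B_Q = 1 + 2(d+1)K(d+1,L)α₀′`); conclusion: the
[4]-(2.51) majorant `(r_C·(B_Q·e^{δ_Q(ℓ+4)}·r_G·L₀²·c_R)·L₀²·c_R)·(W_C(c)·(Lʲη)_c²)·e^{−ρ_T d(c, y′)}` of `(CC ∘ QcoKHq 𝔮) ∘ GG`.
[cite: Balaban1985BackgroundPropagators, (3.126) p.420, (3.130) p.421, (3.42) p.397, (3.132)–(3.133) p.422, (3.13)–(3.15) pp.392–393, (3.115) p.418, p.398; Balaban1984PropagatorsII, (2.51)–(2.56) pp.232–233, Lemma 2.1 (2.60)–(2.61) p.234] -/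
theorem hasMajorantHom_CQG_of_letters_sq_q [Fintype (geo9K i).Site] {bI : FBondY i → IBondY i} (U₁ : B.Cfg)
    (𝔮 : QLetterY (Matrix (Fin N) (Fin N) ℂ) i) {BQ : ℝ} (hBQ : 0 ≤ BQ)
    (hQ15 : ∀ δ : ℝ, 0 ≤ δ → HasMajorantHom (g := toB6 (geo9K i) R₀ H₀) (blkBK i bI) (blkHK i) (QcoKHq i (trBasis N) B cfg 𝔮 U₁)
      (fun a a' => BQ * Real.exp (δ * ((ℓ : ℝ) + 4)) * Real.exp (-(δ * (geo9K i).dist a a'))))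
    (hGK : GeoOK (geo9K i)) {dF : ℕ} {δ₁ α₁ L₀ : ℝ} (hF : Facts347 (geo9K i) R₀ H₀ dF δ₁ α₁ L₀)
    {σ cR : ℝ} (hrow : RowSum (toB6 (geo9K i) R₀ H₀) σ cR) (hcR : 0 ≤ cR) (hσ : 0 ≤ σ) (hαδ : 0 ≤ α₁ * δ₁)
    {ρG δC ρT rG rC : ℝ} {WC : (geo9K i).Site → ℝ} (hρT : 0 ≤ ρT) (hρTG : ρT ≤ ρG) (hρTC : ρT + σ + α₁ * δ₁ ≤ δC)
    (hrG : 0 ≤ rG) (hrC : 0 ≤ rC) (hWC : ∀ a, 0 ≤ WC a)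
    {CC : (XHK (TrIdx N) i → ℝ) →ₗ[ℝ] (XHK (TrIdx N) i → ℝ)} {GG : (XBK (TrIdx N) i → ℝ) →ₗ[ℝ] (XBK (TrIdx N) i → ℝ)}
    (hG : HasMajorant (g := toB6 (geo9K i) R₀ H₀) (blkBK i bI) GG (fun a b => rG * (geo9K i).len a ^ 2 * Real.exp (-(ρG * (geo9K i).dist a b))))
    (hC : HasMajorant (g := toB6 (geo9K i) R₀ H₀) (blkHK i) CC (fun a b => rC * WC a * Real.exp (-(δC * (geo9K i).dist a b)))) :
    HasMajorantHom (g := toB6 (geo9K i) R₀ H₀) (blkBK i bI) (blkHK i) ((CC ∘ₗ QcoKHq i (trBasis N) B cfg 𝔮 U₁) ∘ₗ GG)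
      (fun a b => (rC * ((BQ * Real.exp ((ρG + σ + α₁ * δ₁) * ((ℓ : ℝ) + 4))) * rG * L₀ ^ 2 * cR) * L₀ ^ 2 * cR) * (WC a * (geo9K i).len a ^ 2) *
        Real.exp (-(ρT * (geo9K i).dist a b))) := by
  have hρG : 0 ≤ ρG := hρT.trans hρTG
  have hδQ : 0 ≤ ρG + σ + α₁ * δ₁ := add_nonneg (add_nonneg hρG hσ) hαδ
  -- Q : fine → coarse at the rate δ_Q := ρ_G + σ + α₁δ₁ (the displayed law)
  have hQ := hQ15 (ρG + σ + α₁ * δ₁) hδQ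
  -- (1) `Q ∘ G_D`: insert the partition on the fine blocks, transfer the square scale to the coarse block, sum by (2.61) — rate ρ_G kept
  have hK₂ : ∀ a b : (geo9K i).Site, 0 ≤ rG * (geo9K i).len a ^ 2 * Real.exp (-(ρG * (geo9K i).dist a b)) :=
    fun a b => mul_nonneg (mul_nonneg hrG (pow_nonneg (hGK.lenpos a).le 2)) (Real.exp_nonneg _)
  have hQG₀ := hasMajorantHom_comp (g := toB6 (geo9K i) R₀ H₀) (blkBK i bI) (blkBK i bI) (blkHK i)
    (T₁ := QcoKHq i (trBasis N) B cfg 𝔮 U₁) (T₂ := GG) hQ ((hasMajorantHom_iff _ _ _).2 hG) hK₂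
  have hQG : HasMajorantHom (g := toB6 (geo9K i) R₀ H₀) (blkBK i bI) (blkHK i) (QcoKHq i (trBasis N) B cfg 𝔮 U₁ ∘ₗ GG)
      (fun a b => ((BQ * Real.exp ((ρG + σ + α₁ * δ₁) * ((ℓ : ℝ) + 4))) * rG * L₀ ^ 2 * cR) * (geo9K i).len a ^ 2 * Real.exp (-(ρG * (geo9K i).dist a b))) := by
    refine hasMajorantHom_mono _ _ hQG₀ fun a b => ?_
    have hs := sum_exp_mul_lensq_le (g := geo9K i) hGK hF hrow (κ₁ := ρG + σ + α₁ * δ₁) (κ₂ := ρG) (m := ρG) hρG le_rfl le_rfl a b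
    calc ∑ y : (toB6 (geo9K i) R₀ H₀).Site, (BQ * Real.exp ((ρG + σ + α₁ * δ₁) * ((ℓ : ℝ) + 4))) * Real.exp (-((ρG + σ + α₁ * δ₁) * (geo9K i).dist a y)) *
          (rG * (geo9K i).len y ^ 2 * Real.exp (-(ρG * (geo9K i).dist y b)))
        = (BQ * Real.exp ((ρG + σ + α₁ * δ₁) * ((ℓ : ℝ) + 4))) * rG *
            ∑ y : (geo9K i).Site, Real.exp (-((ρG + σ + α₁ * δ₁) * (geo9K i).dist a y)) * ((geo9K i).len y ^ 2 * Real.exp (-(ρG * (geo9K i).dist y b))) := by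
          rw [Finset.mul_sum]; refine Finset.sum_congr rfl fun y _ => ?_; ring
      _ ≤ (BQ * Real.exp ((ρG + σ + α₁ * δ₁) * ((ℓ : ℝ) + 4))) * rG * (L₀ ^ 2 * cR * (geo9K i).len a ^ 2 * Real.exp (-(ρG * (geo9K i).dist a b))) :=
          mul_le_mul_of_nonneg_left hs (mul_nonneg (mul_nonneg hBQ (Real.exp_nonneg _)) hrG)
      _ = ((BQ * Real.exp ((ρG + σ + α₁ * δ₁) * ((ℓ : ℝ) + 4))) * rG * L₀ ^ 2 * cR) * (geo9K i).len a ^ 2 * Real.exp (-(ρG * (geo9K i).dist a b)) := by ring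
  -- (2) `C ∘ (Q ∘ G_D)`: the same move on the coarse blocks, at the target rate ρ_T
  have hKQG : ∀ a b : (geo9K i).Site, 0 ≤ ((BQ * Real.exp ((ρG + σ + α₁ * δ₁) * ((ℓ : ℝ) + 4))) * rG * L₀ ^ 2 * cR) * (geo9K i).len a ^ 2 *
      Real.exp (-(ρG * (geo9K i).dist a b)) := fun a b =>
    mul_nonneg (mul_nonneg (by positivity) (pow_nonneg (hGK.lenpos a).le 2)) (Real.exp_nonneg _)
  have hcomp := hasMajorantHom_comp (g := toB6 (geo9K i) R₀ H₀) (blkBK i bI) (blkHK i) (blkHK i) (T₁ := CC)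
    (T₂ := QcoKHq i (trBasis N) B cfg 𝔮 U₁ ∘ₗ GG) ((hasMajorantHom_iff _ _ _).2 hC) hQG hKQG
  rw [← LinearMap.comp_assoc] at hcomp
  refine hasMajorantHom_mono _ _ hcomp fun a b => ?_
  have hs := sum_exp_mul_lensq_le (g := geo9K i) hGK hF hrow (κ₁ := δC) (κ₂ := ρG) (m := ρT) hρT hρTG hρTC a b
  set K₁ : ℝ := (BQ * Real.exp ((ρG + σ + α₁ * δ₁) * ((ℓ : ℝ) + 4))) * rG * L₀ ^ 2 * cR with hK₁
  have hK₁0 : 0 ≤ K₁ := by positivity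
  calc ∑ y : (toB6 (geo9K i) R₀ H₀).Site, rC * WC a * Real.exp (-(δC * (geo9K i).dist a y)) * (K₁ * (geo9K i).len y ^ 2 * Real.exp (-(ρG * (geo9K i).dist y b)))
      = rC * WC a * K₁ * ∑ y : (geo9K i).Site, Real.exp (-(δC * (geo9K i).dist a y)) * ((geo9K i).len y ^ 2 * Real.exp (-(ρG * (geo9K i).dist y b))) := by
        rw [Finset.mul_sum]; refine Finset.sum_congr rfl fun y _ => ?_; ring
    _ ≤ rC * WC a * K₁ * (L₀ ^ 2 * cR * (geo9K i).len a ^ 2 * Real.exp (-(ρT * (geo9K i).dist a b))) :=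
        mul_le_mul_of_nonneg_left hs (mul_nonneg (mul_nonneg hrC (hWC a)) hK₁0)
    _ = (rC * K₁ * L₀ ^ 2 * cR) * (WC a * (geo9K i).len a ^ 2) * Real.exp (-(ρT * (geo9K i).dist a b)) := by ring

end Majorant

end Literature.MathematicalPhysics.QuantumFieldTheory.Balaban1983to89.B9Eq3126HTransposeCoordsQ

end
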